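import Literature.NumberTheory.Automorphic.Liu2021.AppendixC.AlbaneseTraceIsogeny
import Literature.NumberTheory.Automorphic.Liu2021.AppendixC.HeckeTranslateLevelQuotient
import Literature.NumberTheory.Automorphic.Liu2021.AppendixC.RestOneLevelInvariants
import HarnessLib

/-!
# `∇u^N_K : ∇X_N → ∇X_K` is SURJECTIVE ON GEOMETRIC POINTS for the level quotients of a §4.2 tower
# (Liu 2021 Def. 2.1 (1), §4.2; Mumford §7; Milne 2005 §5) — every pair of small levels, via a small NORMAL sub-level

Topic `Literature/NumberTheory/Automorphic/Liu2021/AppendixC`; namespace `Literature.NumberTheory.Automorphic.Liu2021.AppendixC`.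
PROOF FILE (theorems only; no definition, no named fact, no instance, no `sorry`).  Generic over a §4.2 datum `C : Sec42Data`
([Liu2021] §4.2 l. 2053–2074: `X_K` smooth projective over the reflex field `E`, `u^N_K = C.cpt.X.map f`, `∇u^N_K = C.nablaTr f`
the restriction of `u × u` to `∇X_N → ∇X_K`, Def. 2.1 (1)).

WHAT IS ASSEMBLED (every step is a ★ tree ∕ Mathlib theorem):
* ★ `Motives.surjective_left_of_isSepQuotient`, ★ `isFinite_left_of_isSepQuotient`, ★ `flat_left_of_isSepQuotient`
  (`Motives/FiniteQuotientFlat.lean`; [MumfordAV1970] §7 Thm. p. 66): a quotient `p : X ⟶ Y = X∕Δ` of a smooth projective `X` by a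
  finite group for separated test objects is surjective, finite and flat — hence universally closed and universally open;
* ★ `Nabla.surjective_map_left` (`AppendixC/AlbaneseTraceIsogeny.lean`): `∇p` is then SURJECTIVE (the image of the clopen `∇X` under
  the open and closed `p × p` is clopen and contains `ΔY`, so it contains `∇Y` by minimality, Def. 2.1 (1));
* ★ `AlgPoints.map_surjective_of_surjective_of_isAlgClosed'` (`Motives/AlgPointsMapSurjectiveAlgClosed.lean`; [GortzWedhorn2020]
  Cor. 3.36 + Prop. 4.8): a surjective morphism locally of finite type is surjective on `Ω`-points, `Ω` algebraically closed;
* ★ `Sec42Data.nablaTr_eq_map` (`∇u` IS `Nabla.map u`), ★ `Nabla.map_comp`, ★ `Sec42Data.locallyOfFiniteType_nabla_hom`;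
* ★ `isSepQuotient_quotientLift` (a quotient by `Γ` is a quotient by `Γ ∕ N′` when `N′` acts trivially) and ★
  `C5.SmallLevel.exists_normal_le` (`AppendixC/RestOneLevelInvariants.lean`: small NORMAL sub-levels exist — the open normal subgroup of
  the compact group `K` inside the clopen `N ∩ K`, Mathlib `IsTopologicalGroup.exist_openNormalSubgroup_sub_clopen_nhds_of_one`).

RESULTS:
* §1 `Sec42Data.nablaTr_algPoints_surjective_of_isSepQuotient` — if `u^N_K` is the quotient of `X_N` by a FINITE group of
  automorphisms for separated test objects, `∇u^N_K` is surjective on `Ω`-points (`Ω ⊇ E` algebraically closed);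
  `Sec42Data.exists_finite_isSepQuotient_of_level`, `Sec42Data.nablaTr_algPoints_surjective_of_level` — the same from an action of
  `↥K` on `X_N` trivial on the normal sub-level `N` (the `IsLevelQuotient` shape of the curve records: `M⋆_K = M⋆_N ∕ (K∕N)`,
  [Deligne1979ShimuraVarieties] 2.7.1 (c), [Milne2005ShimuraVarieties] Rem. 5.29 (c)); `K ∕ N` is finite since `K` is compact and
  `N` open.
* §2 `Sec42Data.nablaTr_algPoints_surjective_of_levelQuotients` — **for EVERY pair of small levels `N ≤ K`** (no normality),
  granted level quotients at all normal pairs: shrink `N` to a normal `N♭` (★ `exists_normal_le`), `∇u^{N♭}_K = ∇u^{N♭}_N ≫ ∇u^N_K` (§4.2 functoriality),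
  and a composite is surjective only if its second factor is — VERBATIM the body of the D9op road-2′ support letter
  `RecordNablaTrSurjective` (cell `hodgecm-mathlib`, crux `HLiu418` = stmt-HodgeConjecture-24832, line
  `Cruxes/HLiu418/Lines/F0_D9opRoad2.lean` ed. 4, `stub_U`), whose record fold is three lines over `IsLevelQuotient` (u4) and
  ★ `RecordSystemGS.IsLevelQuotient.act_eq_one_of_mem`.

HC_CM is proved only modulo the 7 printed citations until rung 0 closes; nothing of [Liu2021] is asserted here.  Ours (formalisation
glue); axioms `propext`, `Classical.choice`, `Quot.sound`.

## References
* [Liu2021] Y. Liu, *Fourier–Jacobi cycles and arithmetic relative trace formula*, Camb. J. Math. 9 (2021) = arXiv:2102.11518: Def. 2.1 (1)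
  (FJcycle.tex l. 1171–1176), §4.2 (l. 2060–2070), App. C (F2) (l. 4656–4660).
* [MumfordAV1970] D. Mumford, *Abelian Varieties* (1970), §7 Thm. p. 66 (1)–(3) and Remark.
* [Milne2005ShimuraVarieties] J. S. Milne, *Introduction to Shimura varieties* (2005), §5 p. 57 L7–12, Rem. 5.29 (c) p. 65.
* [Deligne1979ShimuraVarieties] P. Deligne, *Variétés de Shimura*, Proc. Symp. Pure Math. 33 (1979), 2.7.1 (b)–(c).
* [GortzWedhorn2020] U. Görtz, T. Wedhorn, *Algebraic Geometry I* (2nd ed. 2020), Cor. 3.36 (p. 83), Prop. 4.8 (p. 98).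
-/

set_option autoImplicit false

noncomputable section

open CategoryTheory AlgebraicGeometry NumberField
open Literature.AlgebraicGeometry.Motives

namespace Literature.NumberTheory.Automorphic.Liu2021.AppendixC

universe u v

section Sec42

variable {F E : Type} [Field F] [NumberField F] [IsTotallyReal F] [Field E] [NumberField E] [Algebra F E]
  [IsTotallyComplex E] [Algebra.IsQuadraticExtension F E]
variable {P5 : PropC5Data F E} {isotropicAt : ℕ → Prop}

namespace Sec42Data

variable (C : Sec42Data P5 isotropicAt)

/-! ## §1 `∇u` is surjective on geometric points for a FINITE quotient `u^N_K = X_N → X_N ∕ Δ = X_K` -/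

/-- Over a locally Noetherian base, locally of finite type implies locally of finite presentation. [folklore] -/
private theorem locallyOfFinitePresentation_of_isLocallyNoetherian'' {S T : Scheme.{u}} (g : S ⟶ T)
    [IsLocallyNoetherian T] [LocallyOfFiniteType g] : LocallyOfFinitePresentation g := by
  rw [HasRingHomProperty.iff_appLE (P := @LocallyOfFinitePresentation)]
  intro U V e
  haveI := IsLocallyNoetherian.component_noetherian (X := T) U
  exact RingHom.FinitePresentation.of_finiteType.mp
    (HasRingHomProperty.appLE @LocallyOfFiniteType g inferInstance U V e)

/-- **`∇u^N_K` is SURJECTIVE ON `Ω`-POINTS when `u^N_K` is a finite group quotient.**  Let `f : N ⟶ K` be levels of a §4.2 datum `C`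
(`u := C.cpt.X.map f : X_N → X_K`, smooth projective over the number field `E`) and let a finite group `Δ` act on `X_N` by
`E`-automorphisms `act` with `u` the quotient for separated test objects (`Motives.IsSepQuotient`).  Then for every algebraically
closed `Ω ⊇ E` the map `∇u : ∇X_N(Ω) → ∇X_K(Ω)` is surjective.  PROOF: `u` is surjective, finite and flat ([MumfordAV1970] §7), hence
universally closed and universally open (flat of finite presentation over the Noetherian `X_K`); `∇u = Nabla.map u`
(★ `nablaTr_eq_map`) is then surjective (★ `Nabla.surjective_map_left`: minimality of `∇X_K`, Def. 2.1 (1)) and locally of finite type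
(★ `locallyOfFiniteType_nabla_hom`), so surjective on `Ω`-points (★ `AlgPoints.map_surjective_of_surjective_of_isAlgClosed'`).
[cite: Liu2021, Def. 2.1 (1) (FJcycle.tex l. 1171–1176) and §4.2 (l. 2062–2064)] [cite: MumfordAV1970, §7 Thm. p. 66]
[cite: GortzWedhorn2020, Cor. 3.36 (p. 83) and Prop. 4.8 (p. 98)] -/
theorem nablaTr_algPoints_surjective_of_isSepQuotient {N K : C5.SmallLevel C.S.K₀} (f : N ⟶ K)
    {Δ : Type v} [Group Δ] [Finite Δ] (act : Δ →* Aut (C.X N))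
    (hq : IsSepQuotient (fun δ => act δ) (C.cpt.X.map f))
    (Ω : Type) [Field Ω] [Algebra E Ω] [IsAlgClosed Ω] :
    Function.Surjective (AlgPoints.map (L := Ω) (C.nablaTr f)) := by
  haveI := C.cpt.smooth_X N
  haveI := C.cpt.smooth_X K
  haveI : IsProper (C.X N).hom := (C.cpt.projective_X N).isProper
  haveI : IsProper (C.X K).hom := (C.cpt.projective_X K).isProper
  haveI : Surjective (C.cpt.X.map f).left :=
    surjective_left_of_isSepQuotient (C.cpt.projective_X N) inferInstance act (C.cpt.X.map f) hq
  haveI : IsFinite (C.cpt.X.map f).left :=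
    isFinite_left_of_isSepQuotient (C.cpt.projective_X N) inferInstance act (C.cpt.X.map f) hq
  haveI : Flat (C.cpt.X.map f).left :=
    flat_left_of_isSepQuotient (dX := P5.n - 1) (dY := P5.n - 1) (C.cpt.projective_X N) (C.cpt.projective_X K) act
      (C.cpt.X.map f) hq
  haveI : IsLocallyNoetherian (C.X K).left := LocallyOfFiniteType.isLocallyNoetherian (C.X K).hom
  haveI : LocallyOfFinitePresentation (C.cpt.X.map f).left :=
    locallyOfFinitePresentation_of_isLocallyNoetherian'' (C.cpt.X.map f).left
  haveI : UniversallyOpen (C.cpt.X.map f).left := UniversallyOpen.of_flat (C.cpt.X.map f).left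
  haveI : Surjective ((C.alb N).nabla.map (C.alb K).nabla (C.cpt.X.map f)).left :=
    (C.alb N).nabla.surjective_map_left (C.alb K).nabla (C.cpt.X.map f)
  haveI := C.locallyOfFiniteType_nabla_hom N
  rw [C.nablaTr_eq_map f]
  exact AlgPoints.map_surjective_of_surjective_of_isAlgClosed' _

/-- **A level quotient by `↥K` trivial on the normal sub-level `N` IS a quotient by a FINITE group** (`K ∕ N`; `K` compact, `N` open):
from an action `act : ↥K →* Aut X_N` with `act k = 1` for `k ∈ N` making `u^N_K` the quotient of `X_N` for separated test objects one
gets a finite group `Δ = K ∕ N`, an action `act′ : Δ →* Aut X_N` consisting of the `act k`, and `u^N_K = X_N → X_N ∕ Δ` (the universal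
property only sees the set `{act k}`: ★ `isSepQuotient_quotientLift`).  [cite: Milne2005ShimuraVarieties, §5 p. 57 L7–12 and Rem. 5.29 (c) p. 65]
[cite: Deligne1979ShimuraVarieties, 2.7.1 (b)–(c)] [cite: MumfordAV1970, §7 Thm. p. 66 (Remark)] -/
theorem exists_finite_isSepQuotient_of_level ⦃N K : C5.SmallLevel C.S.K₀⦄ (hNK : N ≤ K)
    (hn : ∀ k ∈ K.1.1, ∀ n ∈ N.1.1, k⁻¹ * n * k ∈ N.1.1)
    (act : ↥K.1.1 →* Aut (C.X N)) (hq : IsSepQuotient (fun k => act k) (C.cpt.X.map (homOfLE hNK)))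
    (hker : ∀ k : ↥K.1.1, (k : C.G) ∈ N.1.1 → act k = 1) :
    ∃ (Δ : Type) (_ : Group Δ) (_ : Finite Δ) (act' : Δ →* Aut (C.X N)),
      (∀ δ, ∃ k : ↥K.1.1, act' δ = act k) ∧ IsSepQuotient (fun δ => act' δ) (C.cpt.X.map (homOfLE hNK)) := by
  let Kg : Subgroup C.G := K.1.1
  let Ng : Subgroup ↥Kg := N.1.1.subgroupOf K.1.1
  have hmemNg : ∀ x : ↥Kg, x ∈ Ng ↔ (x : C.G) ∈ N.1.1 := fun x => Subgroup.mem_subgroupOf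
  haveI hNn : Ng.Normal := ⟨fun n hn' g => by
    rw [hmemNg] at hn' ⊢
    have h1 := hn (g⁻¹ : ↥Kg) (g⁻¹).2 _ hn'
    simpa only [Subgroup.coe_inv, inv_inv, Subgroup.coe_mul] using h1⟩
  haveI : CompactSpace ↥Kg := isCompact_iff_compactSpace.1 K.1.2.2
  have hNo : IsOpen (Ng : Set ↥Kg) := N.1.2.1.preimage continuous_subtype_val
  haveI : Finite (↥Kg ⧸ Ng) := Subgroup.quotient_finite_of_isOpen Ng hNo
  have hker' : ∀ n ∈ Ng, act n = 1 := fun n hn' => hker n ((hmemNg n).1 hn')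
  refine ⟨↥Kg ⧸ Ng, inferInstance, inferInstance, QuotientGroup.lift Ng act hker', fun δ => ?_,
    isSepQuotient_quotientLift Ng act hker' hq⟩
  obtain ⟨k, rfl⟩ := QuotientGroup.mk_surjective δ
  exact ⟨k, rfl⟩

/-- **`∇u^N_K` is surjective on `Ω`-points for a level quotient by `↥K` trivial on the normal sub-level `N`** (the
`IsLevelQuotient` shape: `M⋆_K = M⋆_N ∕ (K∕N)`), `Ω ⊇ E` algebraically closed: §1 through the finite group `K ∕ N`
(`exists_finite_isSepQuotient_of_level`). [cite: Liu2021, Def. 2.1 (1) (FJcycle.tex l. 1171–1176)]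
[cite: Milne2005ShimuraVarieties, Rem. 5.29 (c) p. 65] [cite: MumfordAV1970, §7 Thm. p. 66] -/
theorem nablaTr_algPoints_surjective_of_level ⦃N K : C5.SmallLevel C.S.K₀⦄ (hNK : N ≤ K)
    (hn : ∀ k ∈ K.1.1, ∀ n ∈ N.1.1, k⁻¹ * n * k ∈ N.1.1)
    (act : ↥K.1.1 →* Aut (C.X N)) (hq : IsSepQuotient (fun k => act k) (C.cpt.X.map (homOfLE hNK)))
    (hker : ∀ k : ↥K.1.1, (k : C.G) ∈ N.1.1 → act k = 1)
    (Ω : Type) [Field Ω] [Algebra E Ω] [IsAlgClosed Ω] :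
    Function.Surjective (AlgPoints.map (L := Ω) (C.nablaTr (homOfLE hNK))) := by
  obtain ⟨Δ, _instG, _instF, act', -, hq'⟩ := C.exists_finite_isSepQuotient_of_level hNK hn act hq hker
  exact C.nablaTr_algPoints_surjective_of_isSepQuotient (homOfLE hNK) act' hq' Ω

/-! ## §2 Every pair of small levels `N ≤ K`: shrink to a normal sub-level and factor `∇u^{N♭}_K = ∇u^{N♭}_N ≫ ∇u^N_K` -/

/-- `∇` is functorial along the tower: `∇u^{N″}_K = ∇u^{N″}_N ≫ ∇u^N_K` for `N″ ≤ N ≤ K` (Def. 2.1 (1): each is the restriction of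
`u × u`, and `u^{N″}_K = u^{N″}_N ≫ u^N_K`; ★ `nablaTr_eq_map`, ★ `Nabla.map_comp`). [cite: Liu2021, Def. 2.1 (1) (FJcycle.tex l. 1174–1176) and §4.2 (l. 2064)] -/
theorem nablaTr_homOfLE_trans {N'' N K : C5.SmallLevel C.S.K₀} (h₁ : N'' ≤ N) (h₂ : N ≤ K) :
    C.nablaTr (homOfLE (h₁.trans h₂)) = C.nablaTr (homOfLE h₁) ≫ C.nablaTr (homOfLE h₂) := by
  rw [C.nablaTr_eq_map, C.nablaTr_eq_map, C.nablaTr_eq_map, ← Nabla.map_comp, ← C.cpt.X.map_comp]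
  rfl

/-- **`∇u^N_K : ∇X_N(Ω) → ∇X_K(Ω)` is SURJECTIVE for EVERY pair of sufficiently small levels `N ≤ K`**, `Ω ⊇ E` algebraically closed,
granted that the tower has LEVEL QUOTIENTS at all normal pairs (`hLQ`: for `N′ ≤ K′` with `N′` normalised by `K′`, an action of `↥K′`
on `X_{N′}` trivial on `N′` with `u^{N′}_{K′}` its quotient for separated test objects — the §4.2-datum shadow of the curve records'
`IsLevelQuotient`, [Deligne1979ShimuraVarieties] 2.7.1 (c), [Milne2005ShimuraVarieties] Rem. 5.29 (c)).  PROOF: take a small normal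
sub-level `N♭ ≤ N` of `K` (★ `C5.SmallLevel.exists_normal_le`); `∇u^{N♭}_K` is surjective on `Ω`-points (§1) and equals
`∇u^{N♭}_N ≫ ∇u^N_K` (`nablaTr_homOfLE_trans`), so `∇u^N_K` is surjective.  This is the body of the D9op road-2′ support letter
`RecordNablaTrSurjective` generically. [cite: Liu2021, Def. 2.1 (1) (FJcycle.tex l. 1171–1176), §4.2 (l. 2062–2064) and App. C (F2) (l. 4656–4660)]
[cite: MumfordAV1970, §7 Thm. p. 66] [cite: Milne2005ShimuraVarieties, §5 p. 57 L7–12 and Rem. 5.29 (c) p. 65] -/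
theorem nablaTr_algPoints_surjective_of_levelQuotients
    (hLQ : ∀ ⦃N K : C5.SmallLevel C.S.K₀⦄ (h : N ≤ K), (∀ k ∈ K.1.1, ∀ n ∈ N.1.1, k⁻¹ * n * k ∈ N.1.1) →
      ∃ act : ↥K.1.1 →* Aut (C.X N),
        (∀ k : ↥K.1.1, (k : C.G) ∈ N.1.1 → act k = 1) ∧ IsSepQuotient (fun k => act k) (C.cpt.X.map (homOfLE h)))
    {N K : C5.SmallLevel C.S.K₀} (hNK : N ≤ K) (Ω : Type) [Field Ω] [Algebra E Ω] [IsAlgClosed Ω] :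
    Function.Surjective (AlgPoints.map (L := Ω) (C.nablaTr (homOfLE hNK))) := by
  obtain ⟨N', -, hN'N, hn⟩ := C5.SmallLevel.exists_normal_le K N
  replace hn : ∀ k ∈ K.1.1, ∀ n ∈ N'.1.1, k⁻¹ * n * k ∈ N'.1.1 := fun k hk n hn' => hn k hk n hn'
  obtain ⟨act, hker, hq⟩ := hLQ (hN'N.trans hNK) hn
  have hsurj := C.nablaTr_algPoints_surjective_of_level (hN'N.trans hNK) hn act hq hker Ω
  rw [C.nablaTr_homOfLE_trans hN'N hNK] at hsurj
  have hcomp : (AlgPoints.map (L := Ω) (C.nablaTr (homOfLE hN'N) ≫ C.nablaTr (homOfLE hNK))) =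
      AlgPoints.map (L := Ω) (C.nablaTr (homOfLE hNK)) ∘ AlgPoints.map (L := Ω) (C.nablaTr (homOfLE hN'N)) := by
    funext P
    simp only [Function.comp_apply, AlgPoints.map_apply, Category.assoc]
  rw [hcomp] at hsurj
  exact Function.Surjective.of_comp hsurj

end Sec42Data

end Sec42

end Literature.NumberTheory.Automorphic.Liu2021.AppendixC

end
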